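import Summits.KontsevichZagierPeriods.KontsevichZagierPeriods.Theorems.DilationMove.Negative.LoadBearing
import Literature.NumberTheory.Transcendental.BoxCoordinatePowerMap

/-!
# `DilationMove` (stmt-KontsevichZagierPeriods-3872) — negative side III: the orthant hypothesis of
the picked line's stub is load-bearing exactly for even exponents

Refuter (`cdisprove`, cycle 3) by-products for the crux `DilationMove` of route `HurwitzMicroSectors`.
The lead PICKED line `coordpow-api-assembly` (`Cruxes/DilationMove/Lines/coordpow-api-assembly.lean`)
reduces the crux to `stub_orthantCoordPowMove`: for `m ≥ 1`, a representation `r` whose domain lies in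
the OPEN ORTHANT `{x | ∀ i, 0 < xᵢ}`, and `r'` with `r'.domain = Φₘ '' r.domain`
(`Φₘ = BoxIntegral.coordPow m`, `x ↦ (xᵢ^m)ᵢ`) and `r.integrand x = r'.integrand (Φₘ x) · mⁿ ∏ᵢ xᵢ^(m-1)`
on `r.domain`, the difference `[r] − [r']` is one change-of-variables generator. Both stubs are TRUE
(candidate proofs attached to the item). This file records what the orthant hypothesis buys:

* `CoordPowMoveAnyDomain n m` — the stub at fixed `(n, m)` with `r.domain ⊆ {x | ∀ i, 0 < xᵢ}` DELETED
  (the image clause `r'.domain = Φₘ '' r.domain` is kept HONEST, unlike `not_dilationMoveBoxes_symm`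
  of `LoadBearing`, where the target box was simply wrong);
* `not_coordPowMoveAnyDomain_one_even` — for EVEN `m ≥ 2` it is false already in dimension 1:
  `r = [(-1,1), m·t^(m-1)]`, `r' = [[0,1), 1]` (`Φₘ '' (-1,1) = [0,1)` exactly) satisfy every remaining
  clause, values `0 ≠ 1` — `Φₘ` is 2-to-1 and the SIGNED Jacobian `m·t^(m-1)` is odd, so the two sheets
  cancel instead of adding up (with `|m·t^(m-1)|` they would give `2`, also wrong);
* `coordPowMoveAnyDomain_of_odd` — for ODD `m` it HOLDS in every dimension on every domain (`t ↦ t^m` is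
  strictly monotone on `ℝ`, `mⁿ ∏ xᵢ^(m-1) ≥ 0` because `m − 1` is even), so no orthant is needed;
* `coordPowMoveAnyDomain_one_iff_odd` — in dimension 1, for `m ≥ 1`: the orthant-free stub holds iff
  `m` is odd; `orthantCoordPowMove_false_without_orthant` — the stub with the hypothesis deleted
  (all `n`, `m ≥ 1`) is false; `coordPowMove_of_subset_closedOrthant` — the CLOSED orthant
  `{x | ∀ i, 0 ≤ xᵢ}` already suffices (openness of the orthant is not load-bearing).
[Kontsevich–Zagier 2001, §1.2, rule (2)]
-/

noncomputable section

open MeasureTheory Set MvPolynomial intervalIntegral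
open Literature.NumberTheory.Transcendental Literature.ModelTheory.ExponentialFields

namespace Summit.KontsevichZagierPeriods.HurwitzMicroSectors.DilationMoveNegative

/-! ## The orthant-free stub -/

/-- Stub `stub_orthantCoordPowMove` of line `coordpow-api-assembly` at fixed `(n, m)`, with the
orthant hypothesis `r.domain ⊆ {x | ∀ i, 0 < x i}` DELETED and everything else verbatim (tameness of
`Φₘ` on `r.domain`, the honest image clause, the typed Jacobian factor `mⁿ ∏ᵢ xᵢ^(m-1)`). -/
def CoordPowMoveAnyDomain (n m : ℕ) : Prop :=
  ∀ (r r' : KZ.IntegralRep n),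
    IsSemialgebraicMapOn ℚ r.domain (fun x : Fin n → ℝ => BoxIntegral.coordPow m x) →
    r'.domain = (fun x : Fin n → ℝ => BoxIntegral.coordPow m x) '' r.domain →
    (∀ x ∈ r.domain, r.integrand x =
      r'.integrand (BoxIntegral.coordPow m x) * ((m : ℝ) ^ n * ∏ i, x i ^ (m - 1))) →
    KZ.of r - KZ.of r' ∈ KZ.changeOfVariablesRel

/-- The stub with the orthant hypothesis deleted, quantified as in the skeleton (all `n`, `m ≥ 1`). -/
def OrthantCoordPowMoveWithoutOrthant : Prop :=
  ∀ (n m : ℕ), 1 ≤ m → CoordPowMoveAnyDomain n m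

/-! ## Kit: the half-open box `[0,1)` in dimension 1 as a representation domain -/

/-- The half-open box `{x | ∀ i, x i ∈ [0,1)} ⊆ ℝⁿ`. [folklore] -/
def icoBox (n : ℕ) : Set (Fin n → ℝ) := {x | ∀ i, x i ∈ Ico (0 : ℝ) 1}

/-- The half-open box is `ℚ`-semialgebraic. [folklore] -/
theorem isSemialgebraic_icoBox (n : ℕ) : IsSemialgebraic ℚ (icoBox n) := by
  have h : ∀ i : Fin n, IsSemialgebraic ℚ {x : Fin n → ℝ | x i ∈ Ico (0 : ℝ) 1} := by
    intro i
    have h1 := (isSemialgebraic_setOf_eval_le (k := ℚ) (R := ℝ) (ι := Fin n) (C 0) (X i)).inter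
      (isSemialgebraic_setOf_eval_lt (k := ℚ) (R := ℝ) (ι := Fin n) (X i) (C 1))
    have hEq : {x : Fin n → ℝ | x i ∈ Ico (0 : ℝ) 1} =
        {x : Fin n → ℝ | aeval x (C 0 : MvPolynomial (Fin n) ℚ) ≤ aeval x (X i : MvPolynomial (Fin n) ℚ)} ∩
        {x : Fin n → ℝ | aeval x (X i : MvPolynomial (Fin n) ℚ) < aeval x (C 1 : MvPolynomial (Fin n) ℚ)} := by
      ext x
      simp
    rw [hEq]
    exact h1
  have hEq : icoBox n = ⋂ i ∈ (Finset.univ : Finset (Fin n)), {x : Fin n → ℝ | x i ∈ Ico (0 : ℝ) 1} := by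
    ext x
    simp [icoBox]
  rw [hEq]
  exact IsSemialgebraic.biInter _ _ fun i _ => h i

/-- The half-open box is the product set `univ.pi (fun _ => [0,1))`. [folklore] -/
theorem icoBox_eq_pi (n : ℕ) : icoBox n = Set.univ.pi fun _ : Fin n => Ico (0 : ℝ) 1 := by
  ext x
  simp [icoBox]

/-- The half-open box has volume `1`. [folklore] -/
theorem volume_icoBox (n : ℕ) : volume (icoBox n) = 1 := by
  rw [icoBox_eq_pi, volume_pi_pi]
  simp [Real.volume_Ico]

/-- The constant representation `[[0,1)ⁿ, 1]`. [folklore] -/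
def icoRep (n : ℕ) : KZ.IntegralRep n where
  domain := icoBox n
  integrand := fun _ => 1
  isSemialgebraic_domain := isSemialgebraic_icoBox n
  isSemialgebraicFunOn_integrand :=
    (isSemialgebraicFunOn_aeval (isSemialgebraic_icoBox n) (C 1)).congr (fun x _ => by simp)
  integrableOn := by
    refine integrableOn_const ?_
    rw [volume_icoBox]
    exact ENNReal.one_ne_top

/-- Auxiliary: `icoRep_domain`. [folklore] -/
@[simp] theorem icoRep_domain (n : ℕ) : (icoRep n).domain = icoBox n := rfl

/-- Auxiliary: `icoRep_integrand`. [folklore] -/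
@[simp] theorem icoRep_integrand (n : ℕ) : (icoRep n).integrand = fun _ => 1 := rfl

/-- The value of `[[0,1)ⁿ, 1]` is `1`. [folklore] -/
theorem value_icoRep (n : ℕ) : (icoRep n).value = 1 := by
  rw [KZ.IntegralRep.value, icoRep_domain, icoRep_integrand, setIntegral_const]
  simp [Measure.real, volume_icoBox]

/-! ## Even exponents: the orthant hypothesis is load-bearing -/

/-- For even `m ≠ 0`, `Φₘ '' (-1,1) = [0,1)` exactly (dimension 1). [folklore] -/
theorem image_coordPow_symmBox_even {m : ℕ} (hm : Even m) (hm0 : m ≠ 0) :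
    (fun x : Fin 1 → ℝ => BoxIntegral.coordPow m x) '' ibox 1 (-1) 1 = icoBox 1 := by
  ext y
  simp only [mem_image, ibox, icoBox, mem_setOf_eq, Rat.cast_neg, Rat.cast_one, mem_Ioo, mem_Ico]
  constructor
  · rintro ⟨x, hx, rfl⟩ i
    refine ⟨?_, ?_⟩
    · simpa using hm.pow_nonneg (x i)
    · have habs : |x i| < 1 := abs_lt.2 ⟨(hx i).1, (hx i).2⟩
      have h := pow_lt_one₀ (abs_nonneg (x i)) habs hm0
      rw [hm.pow_abs] at h
      simpa using h
  · intro hy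
    refine ⟨fun i => y i ^ ((m : ℝ)⁻¹), fun i => ⟨?_, ?_⟩, ?_⟩
    · exact lt_of_lt_of_le (by norm_num) (Real.rpow_nonneg (hy i).1 _)
    · exact Real.rpow_lt_one (hy i).1 (hy i).2 (by positivity)
    · funext i
      simp only [BoxIntegral.coordPow_apply]
      exact Real.rpow_inv_natCast_pow (hy i).1 hm0

/-- The value of `[(-1,1), m·t^(m-1)]` vanishes for even `m ≠ 0` (odd integrand). [folklore] -/
theorem value_monoRep_symm_even {m : ℕ} (hm : Even m) (hm0 : m ≠ 0) :
    (monoRep (-1) 1 m (m - 1)).value = 0 := by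
  rw [value_monoRep (-1) 1 m (m - 1) (by norm_num), integral_pow]
  have h1 : m - 1 + 1 = m := by omega
  rw [h1]
  push_cast
  rw [hm.neg_one_pow]
  simp

/-- **Even `m ≥ 2`: the orthant-free stub is false in dimension 1.** Witness
`r = [(-1,1), m·t^(m-1)]`, `r' = [[0,1), 1]`: `Φₘ` is polynomial (tame), `Φₘ '' (-1,1) = [0,1)` is the
honest image, the integrand relation is the typed one, and the values are `0 ≠ 1` — the signed
Jacobian of the 2-to-1 map cancels the two sheets. [folklore] -/
theorem not_coordPowMoveAnyDomain_one_even {m : ℕ} (hm : Even m) (hm0 : m ≠ 0) :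
    ¬ CoordPowMoveAnyDomain 1 m := by
  intro h
  have hmem := h (monoRep (-1) 1 m (m - 1)) (icoRep 1)
    ((isSemialgebraicMapOn_aeval (isSemialgebraic_ibox 1 (-1) 1) (fun i => X i ^ m)).congr
      (fun x _ => by funext j; simp))
    (by rw [icoRep_domain, monoRep_domain, image_coordPow_symmBox_even hm hm0])
    (fun x _ => by simp)
  have hv := value_eq_of_mem hmem
  rw [value_monoRep_symm_even hm hm0, value_icoRep] at hv
  exact zero_ne_one hv

/-- In particular `(n, m) = (1, 2)`: squaring on `(-1,1)` with factor `2t` is not a move. [folklore] -/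
theorem not_coordPowMoveAnyDomain_one_two : ¬ CoordPowMoveAnyDomain 1 2 :=
  not_coordPowMoveAnyDomain_one_even even_two two_ne_zero

/-- **Any proof of `stub_orthantCoordPowMove` must use the orthant hypothesis.** [folklore] -/
theorem orthantCoordPowMove_false_without_orthant : ¬ OrthantCoordPowMoveWithoutOrthant :=
  fun h => not_coordPowMoveAnyDomain_one_two (h 1 2 (by norm_num))

/-! ## Odd exponents: no orthant is needed -/

/-- **Odd `m`: the orthant-free stub HOLDS, in every dimension, on every domain.** `t ↦ t^m` is
strictly monotone on `ℝ`, so `Φₘ` is injective everywhere, and `det Φₘ' = mⁿ ∏ xᵢ^(m-1) ≥ 0` since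
`m − 1` is even, so the typed factor is `|det Φₘ'|`. (Positive, but not a Theses statement: it marks
the exact extent of the negative result above.) [folklore] -/
theorem coordPowMoveAnyDomain_of_odd {n m : ℕ} (hm : Odd m) : CoordPowMoveAnyDomain n m := by
  intro r r' hΦ hdom hrel
  refine ⟨n, r, r', fun x => BoxIntegral.coordPow m x, fun x => BoxIntegral.coordPowDeriv m x, hΦ,
    fun x _ => BoxIntegral.hasFDerivWithinAt_coordPow m _ x, ?_, hdom, ?_, rfl⟩
  · intro x _ y _ hxy
    funext i
    have h := congr_fun hxy i
    simp only [BoxIntegral.coordPow_apply] at h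
    exact hm.strictMono_pow.injective h
  · intro x hx
    have he : Even (m - 1) := by
      obtain ⟨k, rfl⟩ := hm
      exact ⟨k, by omega⟩
    rw [hrel x hx, BoxIntegral.det_coordPowDeriv, abs_of_nonneg]
    exact mul_nonneg (by positivity) (Finset.prod_nonneg fun i _ => he.pow_nonneg _)

/-- **Dichotomy in dimension 1.** For `m ≥ 1` the orthant-free stub holds iff `m` is odd. [folklore] -/
theorem coordPowMoveAnyDomain_one_iff_odd {m : ℕ} (hm : 1 ≤ m) :
    CoordPowMoveAnyDomain 1 m ↔ Odd m := by
  refine ⟨fun h => ?_, coordPowMoveAnyDomain_of_odd⟩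
  rcases Nat.even_or_odd m with he | ho
  · exact absurd h (not_coordPowMoveAnyDomain_one_even he (by omega))
  · exact ho

/-! ## The closed orthant already suffices -/

/-- **Openness of the orthant is not load-bearing**: the stub holds verbatim with the CLOSED orthant
`{x | ∀ i, 0 ≤ xᵢ}` (`Φₘ` is injective there, `det Φₘ' ≥ 0`), for every `m ≥ 1`. What the even case
needs is only "no coordinate changes sign on `r.domain`". (Positive, not a Theses statement.)
[folklore] -/
theorem coordPowMove_of_subset_closedOrthant {n m : ℕ} (hm : 1 ≤ m) (r r' : KZ.IntegralRep n)
    (hsub : r.domain ⊆ {x | ∀ i, 0 ≤ x i})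
    (hΦ : IsSemialgebraicMapOn ℚ r.domain (fun x : Fin n → ℝ => BoxIntegral.coordPow m x))
    (hdom : r'.domain = (fun x : Fin n → ℝ => BoxIntegral.coordPow m x) '' r.domain)
    (hrel : ∀ x ∈ r.domain, r.integrand x =
      r'.integrand (BoxIntegral.coordPow m x) * ((m : ℝ) ^ n * ∏ i, x i ^ (m - 1))) :
    KZ.of r - KZ.of r' ∈ KZ.changeOfVariablesRel := by
  have hm0 : m ≠ 0 := by omega
  refine ⟨n, r, r', fun x => BoxIntegral.coordPow m x, fun x => BoxIntegral.coordPowDeriv m x, hΦ,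
    fun x _ => BoxIntegral.hasFDerivWithinAt_coordPow m _ x,
    (BoxIntegral.injOn_coordPow hm0).mono hsub, hdom, ?_, rfl⟩
  intro x hx
  rw [hrel x hx, BoxIntegral.det_coordPowDeriv, abs_of_nonneg]
  exact mul_nonneg (by positivity) (Finset.prod_nonneg fun i _ => pow_nonneg (hsub hx i) _)

end Summit.KontsevichZagierPeriods.HurwitzMicroSectors.DilationMoveNegative

end
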